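import Summits.ABC.ABC.Theses.IneffectiveSubspace
import Summits.ABC.ABC.Theorems.DeepRegimeABC.Negative.WithoutEps
import Literature.NumberTheory.DiophantineGeometry.AbcDepthCensus

/-!
# `DeepRegimeABC` (stmt-ABC-15121): certified census — where the deep cells begin (`ω₅ ≥ 1, …, 7`)

Compute-certificate (line lead `prover-line-stmt-ABC-15121-c1-0`, 2026-08-16; human certificate
objective) for the crux `Summit.ABC.ABC.Theses.IneffectiveSubspace.DeepRegimeABC` (abc with exponent
`1 + ε` on the deep tail `{ω₅(abc) ≥ K(ε)}`, `ω₅(n) := #{p : p⁵ ∣ n}`), with the soundness-proved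
enumeration checker `Literature.NumberTheory.DiophantineGeometry.DepthCensus.checkCell`
(`AbcDepthCensus.lean`).  Companion of `IneffectiveSubspaceDeepRegimeABCCensusDeepTail.lean` (the cells
`ω₅ ≥ 7, …, 12` do not meet the boxes `10¹², …, 10²²`).

**Certified here: the least `c` of an abc triple in each deep cell `{ω₅(abc) ≥ K}`, `K ≤ 7`, exactly.**
With the test `fun a b _ => !(gcd a b == 1)` the checker accepts the box `c ≤ c_K − 1` (no COPRIME
lattice candidate, `depth_lt_of_checkCell_gcd`), and the displayed abc triple lies in the cell:

| `K` | `c_K` = least `c` with `ω₅(abc) ≥ K` | attained by `(a, b, c)` | deep primes |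
|---|---|---|---|
| 1 | `32` | `1 + 31 = 2⁵` | `2` |
| 2 | `243` | `2⁵ + 211 = 3⁵` | `2, 3` |
| 3 | `5312` | `3⁷ + 5⁵ = 2⁶·83` (a hit, `q = 1.0969`) | `2, 3, 5` |
| 4 | `571293` | `2⁶·5⁵ + 13⁵ = 3⁵·2351` | `2, 3, 5, 13` |
| 5 | `260861447` | `13⁵·179 + 2⁸·3⁵·5⁵ = 7⁵·11·17·83` | `2, 3, 5, 7, 13` |
| 6 | `38288446875` | `2⁶·11⁵·1307 + 13⁵·89·751 = 3⁶·5⁵·7⁵` | `2, 3, 5, 7, 11, 13` |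
| 7 | `8458700490625` | `2⁶·13⁵·84463 + 3⁶·17⁵·23·271 = 5⁵·7⁵·11⁵` | `2, 3, 5, 7, 11, 13, 17` |

(`log₁₀ c_K ≈ 1.5, 2.4, 3.7, 5.8, 8.4, 10.6, 12.9`: each further deep prime costs a factor `≈ 10^2.3`;
the size bound `4·(p_K#)⁵ ≤ c³` alone gives `c_7 > 5.2·10⁹`.)  The first HITS (`rad(abc) < c`) of the
cells are `32 = 5 + 3³`, `256 = 13 + 3⁵`, `5312`, `921875` (`Negative/CensusBelowTenPowSeven`),
`301744768 = 3⁵11⁵ + 5⁶7⁵`, `89466096875 = 7⁶11⁵ + 2⁵3⁷·839·1201 = 5⁵31⁵` (Python mirror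
`cert/deep_census.py`; the last two agree with the refuter compute seat's censuses of the cells `5, 6`).

The only computations trusted to the compiler are the seven closed `Bool` equations
`checkCell … = true` (`native_decide`, computational certificate lane; the `K = 7` run walks
`≈ 3·10⁸` lattice steps).  Everything else — the soundness of the checker, the witnesses, the table —
is kernel-checked.
-/

-- `Summit.<Summit>.<Problem>` is the mandated summit-side namespace (CONVENTIONS §2); for the
-- single-conjunct summit `ABC` the two coincide, so the duplicate `ABC.ABC` is deliberate.
set_option linter.dupNamespace false

namespace Summit.ABC.ABC.Theorems.DeepRegimeABC

open Literature.NumberTheory.DiophantineGeometry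
open Literature.NumberTheory.DiophantineGeometry.DepthCensus
open Summit.ABC.ABC.Theorems.DeepRegimeABC.Negative (mem_deep_of_pow_dvd)

/-! ## The coprimality test: no abc triple at all in the cell-in-the-box -/

/-- If the checker accepts the test "`gcd(a,b) ≠ 1`" on the box `c ≤ N`, then no abc triple with
`c ≤ N` has `ω₅(abc) ≥ K`. [folklore] -/
theorem depth_lt_of_checkCell_gcd {N R K : ℕ} (hR : N < (R + 1) ^ 5)
    (h : checkCell N R K (fun a b _ => !(Nat.gcd a b == 1)) = true) {a b c : ℕ}
    (habc : IsABCTriple a b c) (hcN : c ≤ N) :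
    ((a * b * c).primeFactors.filter (fun p => 5 ≤ (a * b * c).factorization p)).card < K := by
  by_contra hK
  have hrun := checkCell_sound hR h habc hcN (not_lt.mp hK)
  have hcop : Nat.gcd a b = 1 := habc.2.2.2
  simp [hcop] at hrun

/-! ## The seven compiled runs -/

/-- Cell `ω₅ ≥ 1`, box `31` (`2⁵ > 31`; no deep prime at all). [folklore] -/
theorem checkCell_gcd_one : checkCell 31 1 1 (fun a b _ => !(Nat.gcd a b == 1)) = true := by
  native_decide

/-- Cell `ω₅ ≥ 2`, box `242` (`3⁵ > 242`). [folklore] -/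
theorem checkCell_gcd_two : checkCell 242 2 2 (fun a b _ => !(Nat.gcd a b == 1)) = true := by
  native_decide

/-- Cell `ω₅ ≥ 3`, box `5311` (`6⁵ > 5311`). [folklore] -/
theorem checkCell_gcd_three : checkCell 5311 5 3 (fun a b _ => !(Nat.gcd a b == 1)) = true := by
  native_decide

/-- Cell `ω₅ ≥ 4`, box `571292` (`15⁵ > 571292`). [folklore] -/
theorem checkCell_gcd_four :
    checkCell 571292 14 4 (fun a b _ => !(Nat.gcd a b == 1)) = true := by
  native_decide

/-- Cell `ω₅ ≥ 5`, box `260861446` (`49⁵ > 260861446`). [folklore] -/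
theorem checkCell_gcd_five :
    checkCell 260861446 48 5 (fun a b _ => !(Nat.gcd a b == 1)) = true := by
  native_decide

/-- Cell `ω₅ ≥ 6`, box `38288446874` (`131⁵ > 38288446874`). [folklore] -/
theorem checkCell_gcd_six :
    checkCell 38288446874 130 6 (fun a b _ => !(Nat.gcd a b == 1)) = true := by
  native_decide

/-- Cell `ω₅ ≥ 7`, box `8458700490624` (`389⁵ > 8458700490624`; ≈ `3·10⁸` lattice steps). [folklore] -/
theorem checkCell_gcd_seven :
    checkCell 8458700490624 388 7 (fun a b _ => !(Nat.gcd a b == 1)) = true := by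
  native_decide

/-! ## Where the cells begin: the lower bounds -/

/-- `ω₅(abc) ≥ 1 ⟹ c ≥ 32`. [folklore] -/
theorem le_of_one_le_depth {a b c : ℕ} (habc : IsABCTriple a b c)
    (hK : 1 ≤ ((a * b * c).primeFactors.filter (fun p => 5 ≤ (a * b * c).factorization p)).card) :
    32 ≤ c := by
  by_contra hlt
  exact absurd hK (not_le.mpr (depth_lt_of_checkCell_gcd (by norm_num) checkCell_gcd_one habc
    (by omega)))

/-- `ω₅(abc) ≥ 2 ⟹ c ≥ 243`. [folklore] -/
theorem le_of_two_le_depth {a b c : ℕ} (habc : IsABCTriple a b c)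
    (hK : 2 ≤ ((a * b * c).primeFactors.filter (fun p => 5 ≤ (a * b * c).factorization p)).card) :
    243 ≤ c := by
  by_contra hlt
  exact absurd hK (not_le.mpr (depth_lt_of_checkCell_gcd (by norm_num) checkCell_gcd_two habc
    (by omega)))

/-- `ω₅(abc) ≥ 3 ⟹ c ≥ 5312`. [folklore] -/
theorem le_of_three_le_depth {a b c : ℕ} (habc : IsABCTriple a b c)
    (hK : 3 ≤ ((a * b * c).primeFactors.filter (fun p => 5 ≤ (a * b * c).factorization p)).card) :
    5312 ≤ c := by
  by_contra hlt
  exact absurd hK (not_le.mpr (depth_lt_of_checkCell_gcd (by norm_num) checkCell_gcd_three habc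
    (by omega)))

/-- `ω₅(abc) ≥ 4 ⟹ c ≥ 571293`. [folklore] -/
theorem le_of_four_le_depth {a b c : ℕ} (habc : IsABCTriple a b c)
    (hK : 4 ≤ ((a * b * c).primeFactors.filter (fun p => 5 ≤ (a * b * c).factorization p)).card) :
    571293 ≤ c := by
  by_contra hlt
  exact absurd hK (not_le.mpr (depth_lt_of_checkCell_gcd (by norm_num) checkCell_gcd_four habc
    (by omega)))

/-- `ω₅(abc) ≥ 5 ⟹ c ≥ 260861447`. [folklore] -/
theorem le_of_five_le_depth {a b c : ℕ} (habc : IsABCTriple a b c)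
    (hK : 5 ≤ ((a * b * c).primeFactors.filter (fun p => 5 ≤ (a * b * c).factorization p)).card) :
    260861447 ≤ c := by
  by_contra hlt
  exact absurd hK (not_le.mpr (depth_lt_of_checkCell_gcd (by norm_num) checkCell_gcd_five habc
    (by omega)))

/-- `ω₅(abc) ≥ 6 ⟹ c ≥ 38288446875`. [folklore] -/
theorem le_of_six_le_depth {a b c : ℕ} (habc : IsABCTriple a b c)
    (hK : 6 ≤ ((a * b * c).primeFactors.filter (fun p => 5 ≤ (a * b * c).factorization p)).card) :
    38288446875 ≤ c := by
  by_contra hlt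
  exact absurd hK (not_le.mpr (depth_lt_of_checkCell_gcd (by norm_num) checkCell_gcd_six habc
    (by omega)))

/-- `ω₅(abc) ≥ 7 ⟹ c ≥ 8458700490625`. [folklore] -/
theorem le_of_seven_le_depth {a b c : ℕ} (habc : IsABCTriple a b c)
    (hK : 7 ≤ ((a * b * c).primeFactors.filter (fun p => 5 ≤ (a * b * c).factorization p)).card) :
    8458700490625 ≤ c := by
  by_contra hlt
  exact absurd hK (not_le.mpr (depth_lt_of_checkCell_gcd (by norm_num) checkCell_gcd_seven habc
    (by omega)))

/-! ## The bounds are attained -/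

/-- Count witnesses: a list of distinct primes each with `p⁵ ∣ n ≠ 0` bounds `ω₅(n)` below. [folklore] -/
theorem card_le_depth_of_forall {n : ℕ} (hn : n ≠ 0) (l : List ℕ) (hl : l.Nodup)
    (h : ∀ p ∈ l, p.Prime ∧ p ^ 5 ∣ n) :
    l.length ≤ (n.primeFactors.filter (fun p => 5 ≤ n.factorization p)).card := by
  rw [← List.toFinset_card_of_nodup hl]
  exact Finset.card_le_card fun p hp => by
    obtain ⟨hpr, hdvd⟩ := h p (List.mem_toFinset.mp hp)
    exact mem_deep_of_pow_dvd hn hpr hdvd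

/-- `1 + 31 = 32 = 2⁵` lies in the cell `ω₅ ≥ 1`. [folklore] -/
theorem firstMember_one : IsABCTriple 1 31 32 ∧
    1 ≤ ((1 * 31 * 32).primeFactors.filter (fun p => 5 ≤ (1 * 31 * 32).factorization p)).card :=
  ⟨⟨by norm_num, by norm_num, by norm_num, by norm_num [Nat.coprime_iff_gcd_eq_one]⟩,
    card_le_depth_of_forall (by norm_num) [2] (by decide) (by decide)⟩

/-- `2⁵ + 211 = 3⁵` lies in the cell `ω₅ ≥ 2`. [folklore] -/
theorem firstMember_two : IsABCTriple 32 211 243 ∧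
    2 ≤ ((32 * 211 * 243).primeFactors.filter (fun p => 5 ≤ (32 * 211 * 243).factorization p)).card :=
  ⟨⟨by norm_num, by norm_num, by norm_num, by norm_num [Nat.coprime_iff_gcd_eq_one]⟩,
    card_le_depth_of_forall (by norm_num) [2, 3] (by decide)
      (by intro p hp; fin_cases hp <;> exact ⟨by norm_num, by norm_num⟩)⟩

/-- `3⁷ + 5⁵ = 2⁶·83` lies in the cell `ω₅ ≥ 3`. [folklore] -/
theorem firstMember_three : IsABCTriple 2187 3125 5312 ∧
    3 ≤ ((2187 * 3125 * 5312).primeFactors.filter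
      (fun p => 5 ≤ (2187 * 3125 * 5312).factorization p)).card :=
  ⟨⟨by norm_num, by norm_num, by norm_num, by norm_num [Nat.coprime_iff_gcd_eq_one]⟩,
    card_le_depth_of_forall (by norm_num) [2, 3, 5] (by decide)
      (by intro p hp; fin_cases hp <;> exact ⟨by norm_num, by norm_num⟩)⟩

/-- `2⁶·5⁵ + 13⁵ = 3⁵·2351` lies in the cell `ω₅ ≥ 4`. [folklore] -/
theorem firstMember_four : IsABCTriple 200000 371293 571293 ∧
    4 ≤ ((200000 * 371293 * 571293).primeFactors.filter
      (fun p => 5 ≤ (200000 * 371293 * 571293).factorization p)).card :=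
  ⟨⟨by norm_num, by norm_num, by norm_num, by norm_num [Nat.coprime_iff_gcd_eq_one]⟩,
    card_le_depth_of_forall (by norm_num) [2, 3, 5, 13] (by decide)
      (by intro p hp; fin_cases hp <;> exact ⟨by norm_num, by norm_num⟩)⟩

/-- `13⁵·179 + 2⁸·3⁵·5⁵ = 7⁵·11·17·83` lies in the cell `ω₅ ≥ 5`. [folklore] -/
theorem firstMember_five : IsABCTriple 66461447 194400000 260861447 ∧
    5 ≤ ((66461447 * 194400000 * 260861447).primeFactors.filter
      (fun p => 5 ≤ (66461447 * 194400000 * 260861447).factorization p)).card :=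
  ⟨⟨by norm_num, by norm_num, by norm_num, by norm_num [Nat.coprime_iff_gcd_eq_one]⟩,
    card_le_depth_of_forall (by norm_num) [2, 3, 5, 7, 13] (by decide)
      (by intro p hp; fin_cases hp <;> exact ⟨by norm_num, by norm_num⟩)⟩

/-- `2⁶·11⁵·1307 + 13⁵·89·751 = 3⁶·5⁵·7⁵` lies in the cell `ω₅ ≥ 6`. [folklore] -/
theorem firstMember_six : IsABCTriple 13471594048 24816852827 38288446875 ∧
    6 ≤ ((13471594048 * 24816852827 * 38288446875).primeFactors.filter
      (fun p => 5 ≤ (13471594048 * 24816852827 * 38288446875).factorization p)).card :=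
  ⟨⟨by norm_num, by norm_num, by norm_num, by norm_num [Nat.coprime_iff_gcd_eq_one]⟩,
    card_le_depth_of_forall (by norm_num) [2, 3, 5, 7, 11, 13] (by decide)
      (by intro p hp; fin_cases hp <;> exact ⟨by norm_num, by norm_num⟩)⟩

/-- `2⁶·13⁵·84463 + 3⁶·17⁵·23·271 = 5⁵·7⁵·11⁵` lies in the cell `ω₅ ≥ 7`. [folklore] -/
theorem firstMember_seven : IsABCTriple 2007073322176 6451627168449 8458700490625 ∧
    7 ≤ ((2007073322176 * 6451627168449 * 8458700490625).primeFactors.filter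
      (fun p => 5 ≤ (2007073322176 * 6451627168449 * 8458700490625).factorization p)).card :=
  ⟨⟨by norm_num, by norm_num, by norm_num, by norm_num [Nat.coprime_iff_gcd_eq_one]⟩,
    card_le_depth_of_forall (by norm_num) [2, 3, 5, 7, 11, 13, 17] (by decide)
      (by intro p hp; fin_cases hp <;> exact ⟨by norm_num, by norm_num⟩)⟩

/-! ## Registered certificate stub of the crux item (stmt-ABC-15121) -/

/-- **Registered certificate `censusFirstMembers`** (crux `DeepRegimeABC`, line SketchIdeator5R2, human
certificate objective): the least `c` of an abc triple in the cell `{ω₅(abc) ≥ K}` is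
`32, 243, 5312, 571293, 260861447, 38288446875, 8458700490625` for `K = 1, …, 7`. [folklore] -/
theorem censusFirstMembers : (∀ a b c : ℕ, Literature.NumberTheory.DiophantineGeometry.IsABCTriple a b c → 7 ≤ ((a * b * c).primeFactors.filter (fun p => 5 ≤ (a * b * c).factorization p)).card → 8458700490625 ≤ c) ∧ (∀ a b c : ℕ, Literature.NumberTheory.DiophantineGeometry.IsABCTriple a b c → 6 ≤ ((a * b * c).primeFactors.filter (fun p => 5 ≤ (a * b * c).factorization p)).card → 38288446875 ≤ c) ∧ (∀ a b c : ℕ, Literature.NumberTheory.DiophantineGeometry.IsABCTriple a b c → 5 ≤ ((a * b * c).primeFactors.filter (fun p => 5 ≤ (a * b * c).factorization p)).card → 260861447 ≤ c) ∧ (∀ a b c : ℕ, Literature.NumberTheory.DiophantineGeometry.IsABCTriple a b c → 4 ≤ ((a * b * c).primeFactors.filter (fun p => 5 ≤ (a * b * c).factorization p)).card → 571293 ≤ c) ∧ (∀ a b c : ℕ, Literature.NumberTheory.DiophantineGeometry.IsABCTriple a b c → 3 ≤ ((a * b * c).primeFactors.filter (fun p => 5 ≤ (a * b * c).factorization p)).card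 → 5312 ≤ c) ∧ (∀ a b c : ℕ, Literature.NumberTheory.DiophantineGeometry.IsABCTriple a b c → 2 ≤ ((a * b * c).primeFactors.filter (fun p => 5 ≤ (a * b * c).factorization p)).card → 243 ≤ c) ∧ (∀ a b c : ℕ, Literature.NumberTheory.DiophantineGeometry.IsABCTriple a b c → 1 ≤ ((a * b * c).primeFactors.filter (fun p => 5 ≤ (a * b * c).factorization p)).card → 32 ≤ c) ∧ (∃ a b c : ℕ, Literature.NumberTheory.DiophantineGeometry.IsABCTriple a b c ∧ 7 ≤ ((a * b * c).primeFactors.filter (fun p => 5 ≤ (a * b * c).factorization p)).card ∧ c = 8458700490625) :=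
  ⟨fun _ _ _ h hK => le_of_seven_le_depth h hK, fun _ _ _ h hK => le_of_six_le_depth h hK,
    fun _ _ _ h hK => le_of_five_le_depth h hK, fun _ _ _ h hK => le_of_four_le_depth h hK,
    fun _ _ _ h hK => le_of_three_le_depth h hK, fun _ _ _ h hK => le_of_two_le_depth h hK,
    fun _ _ _ h hK => le_of_one_le_depth h hK,
    ⟨_, _, _, firstMember_seven.1, firstMember_seven.2, rfl⟩⟩

end Summit.ABC.ABC.Theorems.DeepRegimeABC
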